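import Summits.QuantumAdvantage.QuantumAdvantage.Theorems.SosSandwichPseudoBoundedAALevelOneRung
import Literature.Computability.Complexity.FourierDegreeAlgebra
import Literature.Computability.QuantumComplexity.InfluenceBounds
import Literature.Analysis.Approximation.MarkovInequality
import HarnessLib

/-!
# Route `SosSandwich`, crux `PseudoBoundedAA` (stmt-QuantumAdvantage-15237): the ℓ¹-SENSITIVITY of a bounded
# low-degree function is `O(d²)` at every vertex

The crux `PseudoBoundedAA` (PB-AA) asks for an influential variable in every pseudo-bounded `p ∈ K_T` with
`Var[p] ≥ ε`; its open content is the dependence of the bound on `T` (equivalently on the degree `d = 2T`).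
This file proves a LEVEL-FREE structural inequality for every bounded function of Fourier degree `≤ d` on the
cube, from which the sequel `Theorems/SosSandwichPseudoBoundedAAVarianceSquared.lean` derives the sharp
VARIANCE exponent `2` of PB-AA / `AA_Q` at every fixed degree (`maxᵢ Infᵢ[p] ≥ 4·Var[p]²/(9^d d⁴)`):

* `attenuate_eq_average`, `abs_attenuate_le` — the **coordinate-attenuation identity**: for rates
  `s : Fin N → [-1, 1]`, `Σ_T (Π_{i∈T} s_i) ĝ(T) χ_T(x) = 2^{-N} Σ_y g(y) Π_i (1 + s_i χ_i(x) χ_i(y))`, an average of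
  `g` against a nonnegative kernel of mass `1` (the noise operator with a separate rate per coordinate,
  O'Donnell 2014 §2.4), hence bounded by `M` when `|g| ≤ M`.
* `abs_weightedSum_le` — for a set `A` of coordinates, the ATTENUATION POLYNOMIAL
  `Q_{x,A}(ρ) = Σ_T ρ^{|T ∩ A|} ĝ(T) χ_T(x)` (rate `ρ` on `A`, rate `1` off `A`) has degree `≤ d`, is `M`-bounded on
  `[-1, 1]`, and `Q'_{x,A}(1) = Σ_T |T ∩ A| ĝ(T) χ_T(x)`; Markov's inequality (tree:
  `Literature.Analysis.Approximation.markov_inequality`, Korneichuk Thm. 3.5.8) gives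
  `|Σ_T |T ∩ A| ĝ(T) χ_T(x)| ≤ d²·M`.
* `sum_sub_flipBit_eq`, `abs_sum_sub_flipBit_le` — since `g(x) - g(x^{⊕i}) = 2 Σ_{T∋i} ĝ(T) χ_T(x)`, the signed sum
  over any set of coordinates is `Σ_{i∈A} (g(x) - g(x^{⊕i})) = 2 Q'_{x,A}(1)`, so it is at most `2 d² M` in
  absolute value, for EVERY `A` and EVERY vertex `x`.
* `sum_abs_sub_flipBit_le` — **the ℓ¹-sensitivity bound**: splitting the coordinates by the sign of
  `g(x) - g(x^{⊕i})`, `Σ_i |g(x) - g(x^{⊕i})| ≤ 4 d² M` at every vertex; for a real polynomial `p` of total degree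
  `≤ d` with `0 ≤ p ≤ 1` on `{0,1}^N` (`M = 1/2` after centring): `Σ_i |p(x) - p(x^{⊕i})| ≤ 2 d²`
  (`sum_abs_sub_flipBit_le_of_bounded`); on `K_T` and on `Q_T` (order / query count `T`, degree `2T`): `≤ 8T²` at every
  vertex (`sum_abs_sub_flipBit_le_pseudoBounded`, `sum_abs_sub_flipBit_le_query`), and conversely a vertex with
  `Σ_i |p(x) - p(x^{⊕i})| > 8T²` certifies `p ∉ K_T` with no SDP (`not_pseudoBounded_of_sensitivity_gt`).

Why this matters for the crux: the inequality is uniform in the vertex and polynomial in `d`; averaged over `x` and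
combined with hypercontractivity it bounds `Σ_i √Inf_i[p]` (sequel file), which is what converts the Poincaré
inequality `4 Var ≤ Σ_i Inf_i` into a max-influence lower bound with `Var²` — the exponent forced by the mean
function (`Theorems/SosSandwichHomogeneousPBAATExponent.lean`: `c ≥ 2`).

Honest label: a support lemma (analytic tool, valid for all bounded low-degree functions); no stub, crux or summit
is proved.  Sources: Korneichuk 1991 Thm. 3.5.8 (Markov); O'Donnell 2014 §2.2 (influences, `x^{⊕i}`), §2.4 (noise
operator as an averaging operator); Nisan–Szegedy 1994 (Markov's inequality as the source of degree lower bounds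
on the cube — the method); Aaronson–Ambainis 2014 Conj. 6.
-/

-- D-0017: single-conjunct summit ⇒ the duplicate `QuantumAdvantage.QuantumAdvantage` is mandated.
set_option linter.dupNamespace false

noncomputable section

namespace Summit.QuantumAdvantage.QuantumAdvantage.Theorems.SosSandwich.GradientBound

open Finset
open Literature.Computability.QuantumComplexity
open Literature.Computability.Complexity.LowDegree (cubeFourierCoeff sum_cubeFourierCoeff_mul_walsh
  sum_walsh_mul_walsh_index IsLevelLE)
open Literature.Probability.RandomGraphs.LowDegree (sgn walsh sgn_true sgn_false walsh_empty)
open Literature.Computability.Cryptography (QQueryAlg)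

variable {N : ℕ}

/-! ### §1 The coordinate-attenuation kernel `Π_i (1 + s_i χ_i(x) χ_i(y))` -/

/-- The kernel with one rate per coordinate expands over characters:
`Π_i (1 + s_i χ_i(x) χ_i(y)) = Σ_T (Π_{i∈T} s_i) χ_T(x) χ_T(y)`. [cite: ODonnell2014, §2.4 (noise operator, Fourier formula)] -/
theorem prod_one_add_rates (s : Fin N → ℝ) (x y : Fin N → Bool) :
    ∏ i, (1 + s i * sgn (x i) * sgn (y i)) =
      ∑ T : Finset (Fin N), (∏ i ∈ T, s i) * (walsh T x * walsh T y) := by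
  rw [Finset.prod_one_add, Finset.powerset_univ]
  refine Finset.sum_congr rfl fun T _ => ?_
  rw [walsh, walsh, ← Finset.prod_mul_distrib, ← Finset.prod_mul_distrib]
  exact Finset.prod_congr rfl fun i _ => by ring

/-- **Coordinate attenuation is averaging.**  For every rate vector `s`,
`Σ_T (Π_{i∈T} s_i) ĝ(T) χ_T(x) = 2^{-N} Σ_y g(y) Π_i (1 + s_i χ_i(x) χ_i(y))` — the noise operator with a separate
rate per coordinate, evaluated at `x`. [cite: ODonnell2014, §2.4 (T_ρ as an averaging operator)] -/
theorem attenuate_eq_average (g : (Fin N → Bool) → ℝ) (s : Fin N → ℝ) (x : Fin N → Bool) :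
    ∑ T : Finset (Fin N), (∏ i ∈ T, s i) * cubeFourierCoeff g T * walsh T x =
      (∑ y, g y * ∏ i, (1 + s i * sgn (x i) * sgn (y i))) / 2 ^ N := by
  simp_rw [prod_one_add_rates, Finset.mul_sum]
  rw [Finset.sum_comm, Finset.sum_div]
  refine Finset.sum_congr rfl fun T _ => ?_
  simp only [cubeFourierCoeff, Finset.sum_div, Finset.mul_sum, Finset.sum_mul]
  exact Finset.sum_congr rfl fun y _ => by ring

/-- The kernel is nonnegative when every rate lies in `[-1, 1]`. [folklore] -/
theorem kernel_nonneg {s : Fin N → ℝ} (hs : ∀ i, |s i| ≤ 1) (x y : Fin N → Bool) :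
    0 ≤ ∏ i, (1 + s i * sgn (x i) * sgn (y i)) :=
  Finset.prod_nonneg fun i _ => by
    have hx : |sgn (x i)| = 1 := by cases x i <;> simp [sgn]
    have hy : |sgn (y i)| = 1 := by cases y i <;> simp [sgn]
    have h1 : |s i * sgn (x i) * sgn (y i)| ≤ 1 := by
      rw [abs_mul, abs_mul, hx, hy, mul_one, mul_one]; exact hs i
    linarith [neg_abs_le (s i * sgn (x i) * sgn (y i))]

/-- The kernel has total mass `2^N` (only the empty character survives the sum over `y`). [folklore] -/
theorem sum_kernel (s : Fin N → ℝ) (x : Fin N → Bool) :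
    ∑ y : Fin N → Bool, ∏ i, (1 + s i * sgn (x i) * sgn (y i)) = 2 ^ N := by
  simp_rw [prod_one_add_rates]
  rw [Finset.sum_comm]
  have h : ∀ T : Finset (Fin N), ∑ y : Fin N → Bool, (∏ i ∈ T, s i) * (walsh T x * walsh T y) =
      (∏ i ∈ T, s i) * walsh T x * (if T = ∅ then (2 : ℝ) ^ N else 0) := by
    intro T
    rw [← sum_walsh_mul_walsh_index T ∅, Finset.mul_sum]
    exact Finset.sum_congr rfl fun y _ => by rw [walsh_empty]; ring
  simp_rw [h]
  rw [Finset.sum_eq_single ∅]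
  · simp
  · intro T _ hT
    rw [if_neg hT, mul_zero]
  · intro h0
    exact absurd (Finset.mem_univ _) h0

/-- **An attenuated value is bounded like the function**: `|g| ≤ M` on the cube and rates in `[-1, 1]` give
`|Σ_T (Π_{i∈T} s_i) ĝ(T) χ_T(x)| ≤ M`. [cite: ODonnell2014, §2.4 (T_ρ is a contraction in sup norm)] -/
theorem abs_attenuate_le {M : ℝ} {g : (Fin N → Bool) → ℝ} (hM : ∀ y, |g y| ≤ M) {s : Fin N → ℝ}
    (hs : ∀ i, |s i| ≤ 1) (x : Fin N → Bool) :
    |∑ T : Finset (Fin N), (∏ i ∈ T, s i) * cubeFourierCoeff g T * walsh T x| ≤ M := by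
  rw [attenuate_eq_average, abs_div, abs_of_pos (by positivity : (0 : ℝ) < 2 ^ N),
    div_le_iff₀ (by positivity)]
  calc |∑ y, g y * ∏ i, (1 + s i * sgn (x i) * sgn (y i))|
      ≤ ∑ y, |g y * ∏ i, (1 + s i * sgn (x i) * sgn (y i))| := Finset.abs_sum_le_sum_abs _ _
    _ ≤ ∑ y, M * ∏ i, (1 + s i * sgn (x i) * sgn (y i)) := Finset.sum_le_sum fun y _ => by
        rw [abs_mul, abs_of_nonneg (kernel_nonneg hs x y)]
        exact mul_le_mul_of_nonneg_right (hM y) (kernel_nonneg hs x y)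
    _ = M * 2 ^ N := by rw [← Finset.mul_sum, sum_kernel]

/-! ### §2 The attenuation polynomial `Q_{x,A}(ρ) = Σ_T ρ^{|T ∩ A|} ĝ(T) χ_T(x)` and Markov's inequality -/

/-- Rate `ρ` on `A` and rate `1` off `A`: `Π_{i∈T} s_i = ρ^{|T ∩ A|}`. [folklore] -/
theorem prod_rate_eq_pow (A T : Finset (Fin N)) (ρ : ℝ) :
    ∏ i ∈ T, (if i ∈ A then ρ else (1 : ℝ)) = ρ ^ (T ∩ A).card := by
  rw [Finset.prod_ite_mem, Finset.prod_const]

/-- Such rates lie in `[-1, 1]` when `ρ` does. [folklore] -/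
theorem abs_rate_le {ρ : ℝ} (hρ : ρ ∈ Set.Icc (-1 : ℝ) 1) (A : Finset (Fin N)) (i : Fin N) :
    |(if i ∈ A then ρ else (1 : ℝ))| ≤ 1 := by
  split_ifs
  · exact abs_le.mpr ⟨by linarith [hρ.1], hρ.2⟩
  · simp

/-- Evaluation of the attenuation polynomial: `Q_{x,A}(ρ) = Σ_T (Π_{i∈T} s_i) ĝ(T) χ_T(x)` with the rates of
`prod_rate_eq_pow`. [folklore] -/
theorem eval_attPoly (g : (Fin N → Bool) → ℝ) (A : Finset (Fin N)) (x : Fin N → Bool) (ρ : ℝ) :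
    (∑ T : Finset (Fin N), Polynomial.C (cubeFourierCoeff g T * walsh T x) *
        Polynomial.X ^ (T ∩ A).card).eval ρ =
      ∑ T : Finset (Fin N), (∏ i ∈ T, (if i ∈ A then ρ else (1 : ℝ))) * cubeFourierCoeff g T * walsh T x := by
  rw [Polynomial.eval_finsetSum]
  exact Finset.sum_congr rfl fun T _ => by
    rw [Polynomial.eval_mul, Polynomial.eval_C, Polynomial.eval_pow, Polynomial.eval_X, prod_rate_eq_pow]
    ring

/-- The attenuation polynomial of an `M`-bounded `g` is `M`-bounded on `[-1, 1]`. [cite: ODonnell2014, §2.4] -/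
theorem abs_eval_attPoly_le {M : ℝ} {g : (Fin N → Bool) → ℝ} (hM : ∀ y, |g y| ≤ M) (A : Finset (Fin N))
    (x : Fin N → Bool) {ρ : ℝ} (hρ : ρ ∈ Set.Icc (-1 : ℝ) 1) :
    |(∑ T : Finset (Fin N), Polynomial.C (cubeFourierCoeff g T * walsh T x) *
        Polynomial.X ^ (T ∩ A).card).eval ρ| ≤ M := by
  rw [eval_attPoly]
  exact abs_attenuate_le hM (fun i => abs_rate_le hρ A i) x

/-- The attenuation polynomial of a function of Fourier degree `≤ d` has degree `≤ d` (`|T ∩ A| ≤ |T|`). [folklore] -/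
theorem degree_attPoly_le {d : ℕ} {g : (Fin N → Bool) → ℝ} (hdeg : IsLevelLE d g) (A : Finset (Fin N))
    (x : Fin N → Bool) :
    (∑ T : Finset (Fin N), Polynomial.C (cubeFourierCoeff g T * walsh T x) *
        Polynomial.X ^ (T ∩ A).card).degree ≤ (d : WithBot ℕ) := by
  refine (Polynomial.degree_sum_le _ _).trans (Finset.sup_le fun T _ => ?_)
  by_cases hT : d < T.card
  · rw [hdeg T hT, zero_mul, map_zero, zero_mul, Polynomial.degree_zero]
    exact bot_le
  · refine (Polynomial.degree_C_mul_X_pow_le _ _).trans ?_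
    have h : (T ∩ A).card ≤ d :=
      (Finset.card_le_card Finset.inter_subset_left).trans (Nat.le_of_not_lt hT)
    exact_mod_cast h

/-- The derivative of the attenuation polynomial at `ρ = 1` is the weighted sum `Σ_T |T ∩ A| ĝ(T) χ_T(x)`. [folklore] -/
theorem eval_one_derivative_attPoly (g : (Fin N → Bool) → ℝ) (A : Finset (Fin N)) (x : Fin N → Bool) :
    (Polynomial.derivative (∑ T : Finset (Fin N), Polynomial.C (cubeFourierCoeff g T * walsh T x) *
        Polynomial.X ^ (T ∩ A).card)).eval 1 =
      ∑ T : Finset (Fin N), ((T ∩ A).card : ℝ) * cubeFourierCoeff g T * walsh T x := by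
  rw [Polynomial.derivative_sum, Polynomial.eval_finsetSum]
  exact Finset.sum_congr rfl fun T _ => by
    rw [Polynomial.derivative_C_mul_X_pow, Polynomial.eval_mul, Polynomial.eval_C, Polynomial.eval_pow,
      Polynomial.eval_X, one_pow, mul_one]
    ring

/-- **Markov's inequality for the attenuation polynomial**: for an `M`-bounded `g` of Fourier degree `≤ d`, every
set `A` of coordinates and every vertex `x`, `|Σ_T |T ∩ A| ĝ(T) χ_T(x)| ≤ d²·M`.
[cite: Korneichuk1991, Thm 3.5.8 (§3.5.4)] [cite: ODonnell2014, §2.4] -/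
theorem abs_weightedSum_le {d : ℕ} {M : ℝ} {g : (Fin N → Bool) → ℝ} (hdeg : IsLevelLE d g)
    (hM : ∀ y, |g y| ≤ M) (A : Finset (Fin N)) (x : Fin N → Bool) :
    |∑ T : Finset (Fin N), ((T ∩ A).card : ℝ) * cubeFourierCoeff g T * walsh T x| ≤ (d : ℝ) ^ 2 * M := by
  have h := Literature.Analysis.Approximation.markov_inequality (degree_attPoly_le hdeg A x)
    (fun y hy => abs_eval_attPoly_le hM A x hy) (x := 1) ⟨by norm_num, le_refl _⟩
  rwa [eval_one_derivative_attPoly] at h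

/-! ### §3 Signed sums of bit-flip differences and the ℓ¹-sensitivity bound -/

/-- The bit-flip difference in the Walsh basis: `g(x) - g(x^{⊕i}) = Σ_{T ∋ i} 2 ĝ(T) χ_T(x)`.
[cite: ODonnell2014, §2.2 (derivative operators)] -/
theorem sub_flipBit_eq_sum (g : (Fin N → Bool) → ℝ) (i : Fin N) (x : Fin N → Bool) :
    g x - g (flipBit i x) =
      ∑ T : Finset (Fin N), (if i ∈ T then 2 * cubeFourierCoeff g T else 0) * walsh T x := by
  conv_lhs => rw [← sum_cubeFourierCoeff_mul_walsh g x, ← sum_cubeFourierCoeff_mul_walsh g (flipBit i x)]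
  rw [← Finset.sum_sub_distrib]
  refine Finset.sum_congr rfl fun T _ => ?_
  rw [walsh_flipBit]
  split_ifs <;> ring

/-- **The signed sum over a set of coordinates is twice the derivative of the attenuation polynomial**:
`Σ_{i∈A} (g(x) - g(x^{⊕i})) = 2 Σ_T |T ∩ A| ĝ(T) χ_T(x)`. [cite: ODonnell2014, §2.2] -/
theorem sum_sub_flipBit_eq (g : (Fin N → Bool) → ℝ) (A : Finset (Fin N)) (x : Fin N → Bool) :
    ∑ i ∈ A, (g x - g (flipBit i x)) =
      2 * ∑ T : Finset (Fin N), ((T ∩ A).card : ℝ) * cubeFourierCoeff g T * walsh T x := by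
  simp_rw [sub_flipBit_eq_sum]
  rw [Finset.sum_comm, Finset.mul_sum]
  refine Finset.sum_congr rfl fun T _ => ?_
  rw [← Finset.sum_mul]
  have hc : ∑ i ∈ A, (if i ∈ T then 2 * cubeFourierCoeff g T else 0) =
      2 * ((T ∩ A).card : ℝ) * cubeFourierCoeff g T := by
    rw [Finset.sum_ite_mem, Finset.sum_const, nsmul_eq_mul, Finset.inter_comm]
    ring
  rw [hc]
  ring

/-- **Signed flip-sums are `O(d²)`**: for an `M`-bounded `g` of Fourier degree `≤ d`, every set `A` of coordinates
and every vertex `x`, `|Σ_{i∈A} (g(x) - g(x^{⊕i}))| ≤ 2 d² M`. [cite: Korneichuk1991, Thm 3.5.8 (§3.5.4)]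
[cite: ODonnell2014, §2.2, §2.4] -/
theorem abs_sum_sub_flipBit_le {d : ℕ} {M : ℝ} {g : (Fin N → Bool) → ℝ} (hdeg : IsLevelLE d g)
    (hM : ∀ y, |g y| ≤ M) (A : Finset (Fin N)) (x : Fin N → Bool) :
    |∑ i ∈ A, (g x - g (flipBit i x))| ≤ 2 * (d : ℝ) ^ 2 * M := by
  rw [sum_sub_flipBit_eq, abs_mul, abs_two]
  have h := abs_weightedSum_le hdeg hM A x
  linarith

/-- **The ℓ¹-sensitivity of a bounded low-degree function is at most `4 d² M` at every vertex**:
`Σ_i |g(x) - g(x^{⊕i})| ≤ 4 d² M` for `|g| ≤ M` of Fourier degree `≤ d` (split the coordinates by the sign of the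
difference and apply `abs_sum_sub_flipBit_le` to each part). [cite: Korneichuk1991, Thm 3.5.8 (§3.5.4)]
[cite: ODonnell2014, §2.2, §2.4] -/
theorem sum_abs_sub_flipBit_le {d : ℕ} {M : ℝ} {g : (Fin N → Bool) → ℝ} (hdeg : IsLevelLE d g)
    (hM : ∀ y, |g y| ≤ M) (x : Fin N → Bool) :
    ∑ i, |g x - g (flipBit i x)| ≤ 4 * (d : ℝ) ^ 2 * M := by
  set u : Fin N → ℝ := fun i => g x - g (flipBit i x) with hu
  have hpos := abs_sum_sub_flipBit_le hdeg hM (univ.filter fun i => 0 ≤ u i) x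
  have hneg := abs_sum_sub_flipBit_le hdeg hM (univ.filter fun i => ¬ 0 ≤ u i) x
  have hsplit : ∑ i, |u i| =
      ∑ i ∈ univ.filter (fun i => 0 ≤ u i), |u i| + ∑ i ∈ univ.filter (fun i => ¬ 0 ≤ u i), |u i| :=
    (Finset.sum_filter_add_sum_filter_not _ _ _).symm
  have h1 : ∑ i ∈ univ.filter (fun i => 0 ≤ u i), |u i| = ∑ i ∈ univ.filter (fun i => 0 ≤ u i), u i :=
    Finset.sum_congr rfl fun i hi => abs_of_nonneg (Finset.mem_filter.1 hi).2
  have h2 : ∑ i ∈ univ.filter (fun i => ¬ 0 ≤ u i), |u i| =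
      -∑ i ∈ univ.filter (fun i => ¬ 0 ≤ u i), u i := by
    rw [← Finset.sum_neg_distrib]
    exact Finset.sum_congr rfl fun i hi => abs_of_neg (lt_of_not_ge (Finset.mem_filter.1 hi).2)
  have e : ∑ i, |g x - g (flipBit i x)| = ∑ i, |u i| := rfl
  rw [e, hsplit, h1, h2]
  linarith [le_abs_self (∑ i ∈ univ.filter (fun i => 0 ≤ u i), u i),
    neg_le_abs (∑ i ∈ univ.filter (fun i => ¬ 0 ≤ u i), u i)]

/-- **ℓ¹-sensitivity of a `[0,1]`-valued polynomial of total degree `≤ d`**: `Σ_i |p(x) - p(x^{⊕i})| ≤ 2 d²` at every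
vertex `x` of `{0,1}^N` (centre: `|p - 1/2| ≤ 1/2`, same Fourier coefficients at nonempty sets, Fourier degree
`≤ d`). [cite: Korneichuk1991, Thm 3.5.8 (§3.5.4)] [cite: ODonnell2014, §2.2, §2.4] -/
theorem sum_abs_sub_flipBit_le_of_bounded {d : ℕ} {p : MvPolynomial (Fin N) ℝ} (hp : p.totalDegree ≤ d)
    (hb : ∀ x, 0 ≤ evalBool p x ∧ evalBool p x ≤ 1) (x : Fin N → Bool) :
    ∑ i, |evalBool p x - evalBool p (flipBit i x)| ≤ 2 * (d : ℝ) ^ 2 := by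
  have hdeg : IsLevelLE d (fun y => evalBool p y - 1 / 2) := fun S hS => by
    have hS0 : S ≠ ∅ := by rintro rfl; simp at hS
    rw [LevelOneRung.cubeFourierCoeff_sub_const _ hS0]
    exact cubeFourierCoeff_evalBool_eq_zero hp hS
  have hM : ∀ y, |evalBool p y - 1 / 2| ≤ 1 / 2 := fun y => by
    rw [abs_le]; constructor <;> linarith [(hb y).1, (hb y).2]
  have h := sum_abs_sub_flipBit_le hdeg hM x
  have e : ∀ i, |(fun y => evalBool p y - 1 / 2) x - (fun y => evalBool p y - 1 / 2) (flipBit i x)| =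
      |evalBool p x - evalBool p (flipBit i x)| := fun i => by
    congr 1; ring
  simp only [e] at h
  linarith

/-! ### §4 On the SOS sandwich class `K_T` and on `Q_T`: ℓ¹-sensitivity `≤ 8T²`, a non-membership certificate -/

/-- **Every pseudo-bounded `p ∈ K_T` has ℓ¹-sensitivity at most `8T²` at every vertex**:
`Σ_i |p(x) - p(x^{⊕i})| ≤ 8T²` (`K_T ∋ p` agrees on the cube with a `[0,1]`-bounded representative of total degree
`≤ 2T`; `2·(2T)² = 8T²`). [cite: KaniewskiLeeDewolf2015, Def. 7] [cite: Korneichuk1991, Thm 3.5.8 (§3.5.4)] -/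
theorem sum_abs_sub_flipBit_le_pseudoBounded {T : ℕ} {p : MvPolynomial (Fin N) ℝ} (h : PseudoBounded T p)
    (x : Fin N → Bool) : ∑ i, |evalBool p x - evalBool p (flipBit i x)| ≤ 8 * (T : ℝ) ^ 2 := by
  obtain ⟨p', hdeg, hb, heq⟩ := exists_representative_of_pseudoBounded h
  have h1 := sum_abs_sub_flipBit_le_of_bounded hdeg hb x
  rw [heq] at h1
  have e : (2 : ℝ) * ((2 * T : ℕ) : ℝ) ^ 2 = 8 * (T : ℝ) ^ 2 := by push_cast; ring
  linarith

/-- **A certificate of non-membership in `K_T`**: if at some vertex `Σ_i |p(x) - p(x^{⊕i})| > 8T²`, then `p` is not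
pseudo-bounded of order `T` (no SDP needed). [cite: KaniewskiLeeDewolf2015, Def. 7] [cite: Korneichuk1991, Thm 3.5.8 (§3.5.4)] -/
theorem not_pseudoBounded_of_sensitivity_gt {T : ℕ} {p : MvPolynomial (Fin N) ℝ} {x : Fin N → Bool}
    (hx : 8 * (T : ℝ) ^ 2 < ∑ i, |evalBool p x - evalBool p (flipBit i x)|) : ¬ PseudoBounded T p :=
  fun h => absurd (sum_abs_sub_flipBit_le_pseudoBounded h x) (not_le.mpr hx)

/-- **Every `T`-query quantum acceptance probability has ℓ¹-sensitivity at most `8T²` at every input**: for a real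
polynomial `p` with `Q`'s acceptance probabilities as cube values, `Σ_i |p(x) - p(x^{⊕i})| ≤ 8T²` (the acceptance
polynomial has total degree `≤ 2T` and values in `[0,1]`: Beals et al. + unitarity, tree `exists_acceptPolynomial`).
[cite: BealsEtAl2001, Lemma 4.2] [cite: Korneichuk1991, Thm 3.5.8 (§3.5.4)] -/
theorem sum_abs_sub_flipBit_le_query (Q : QQueryAlg N) (p : MvPolynomial (Fin N) ℝ)
    (hp : ∀ x, evalBool p x = Q.acceptProb x) (x : Fin N → Bool) :
    ∑ i, |evalBool p x - evalBool p (flipBit i x)| ≤ 8 * (Q.queries : ℝ) ^ 2 := by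
  obtain ⟨p₀, hdeg, hval⟩ := exists_acceptPolynomial Q
  have heq : evalBool p = evalBool p₀ := funext fun y => by rw [hp y]; exact hval y
  have hb : ∀ y, 0 ≤ evalBool p₀ y ∧ evalBool p₀ y ≤ 1 := fun y => by
    have hy : evalBool p₀ y = Q.acceptProb y := (hval y).symm
    rw [hy]
    exact ⟨Q.acceptProb_nonneg y, Q.acceptProb_le_one' y⟩
  have h1 := sum_abs_sub_flipBit_le_of_bounded hdeg hb x
  rw [heq]
  have e : (2 : ℝ) * ((2 * Q.queries : ℕ) : ℝ) ^ 2 = 8 * (Q.queries : ℝ) ^ 2 := by push_cast; ring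
  linarith

end Summit.QuantumAdvantage.QuantumAdvantage.Theorems.SosSandwich.GradientBound

end
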